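import Summits.AtomisticToContinuum.Crystallization.Theorems.ChartedPlanarOrderNashForceBalanceLayers

/-!
# IND: the in-plane periods of a separated, clean, stacked layered set are linearly independent (decomp-a2c lens-3 g22)

Blocker `N = ChartedPlanarOrder.ChartedZeroExcessLayered`, PS column: D1a `LayerForceBalance Λ ⟸ CleanStackedIndependent`
(`…ProfileSlavingLJLayerBalance.layerForceBalance_of_indep`, analytic core `…NashForceBalance.hasSum_layerForce_of_isNash`).
This module PROVES the remaining input (critic row 425 (1) «prover-side obligation of D1a/D1s/W»):

* `cleanStackedIndependent` ★★ : `∀ δ > 0, ∀ a b w, IsSep δ (Layered a b w) → IsClean (μS (Layered a b w)) → IsStacked a b w →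
  LinearIndependent ℝ ![a, b]` — verbatim the Prop `CleanStackedIndependent` of `…ProfileSlavingLJLayerBalance`.

Hence D1a `LayerForceBalance Λ` holds for every `Λ` (corollary there), D1 `NashBalance Λ ⟸ StraddleSummable Λ` (D1s) alone, and
`ProfileSlavingLJ Λ η ⟸ SlavingKernelL1 (E1, proved) ∧ StraddleSummable Λ (D1s) ∧ TubeMonotone Λ η (W)`.

Proof. §1 THE PATTERNS SEE EVERY DIRECTION: for every `u : E3` some vector `v` of the fcc / hcp two-shell pattern has `⟪u, v⟫ ≥ ‖u‖/2`
(fcc: the second shell `±√2 eᵢ`; hcp: the in-plane hexagon `±(3,−3,0)/√18,…` controls the differences `uᵢ − uⱼ`, the two triangular caps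
`(3,3,0),…` / `(−1,−1,−4),…` control `u₀ + u₁ + u₂`, and `3‖u‖² = Σ (uᵢ − uⱼ)² + (Σ uᵢ)²`); pattern vectors have norm `≤ 3/2`.
§2 RELATIVE DENSITY: a `δ`-separated set meets closed balls in finite sets (grid injection of `…NashForceBalance`), so the distance from any
`x` to a nonempty separated set is attained at some atom `y`; if `dist x y > 5`, cleanliness at `y` (scale `a ∈ [9/10, 1]`, isometry `A`,
pattern `P`, `(a/16)`-matched neighbours) and §1 applied to `A⁻¹(x − y)` give a neighbour `f v ∈ S` with
`dist x (f v) ≤ dist x y − a/4 + a/16 < dist x y` — contradiction; so every point of space is within `5` of the set (`exists_mem_dist_le_five`).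
§3 INDEPENDENCE: if `a, b` are dependent they lie on a line `ℝc` (`c ∈ {a, b}`, so `c ⊥ n` for the stacking normal `n`); pick `e ≠ 0` with
`e ⊥ n, c` (`(span{n, c})ᗮ ≠ 0` by `finrank` count in `E3`); then along the layered set the coordinates `⟪n, ·⟫` (height) and `⟪e, ·⟫` depend only
on the layer index, heights being STRICTLY INCREASING in it. Atoms within `5` of `±(11/‖n‖) n` give layers `l_d < l_u` with heights
`≤ −6‖n‖` / `≥ 6‖n‖`, so every layer of height in `[−5‖n‖, 5‖n‖]` lies in `Ioo l_d l_u`; atoms within `5` of the probes `(11k/‖e‖) e`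
(`k = 0, …, K`) have such heights and pairwise distinct `⟪e, ·⟫`-windows, hence pairwise distinct layers — `K + 1 ≤ #Ioo l_d l_u` for every `K`,
absurd. (Separation is used only for the finiteness in §2; the norm bounds `‖a‖, ‖b‖ ≤ Λ` and single-site Nash are not needed.)

No new obligations; no instances; no notation. Imports `…NashForceBalance` (grid lemmas, `strictMono_height`).
-/

noncomputable section

open MeasureTheory Set Metric
open scoped RealInnerProductSpace
open Literature.Geometry.DiscreteGeometry
open Summit.AtomisticToContinuum.Crystallization.Theorems.ChartedPlanarOrderRigidityDoor
open Summit.AtomisticToContinuum.Crystallization.Theorems.ChartedPlanarOrderDensityDichotomy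
open Summit.AtomisticToContinuum.Crystallization.Theorems.ChartedPlanarOrderMesoCut
open Summit.AtomisticToContinuum.Crystallization.Theorems.ChartedPlanarOrderProfileSlavingLJ (IsStacked)
open Summit.AtomisticToContinuum.Crystallization.Theorems.ChartedPlanarOrderDoorLayered (Layered)
open Summit.AtomisticToContinuum.Crystallization.Theorems.ChartedPlanarOrderNashForceBalance

namespace Summit.AtomisticToContinuum.Crystallization.Theorems.ChartedPlanarOrderCleanStackedIndependent

/-! ## 1. The two-shell patterns see every direction: `∃ v ∈ P, ‖u‖/2 ≤ ⟪u, v⟫` -/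

/-- the inner product with a scaled integer vector, in coordinates. -/
theorem inner_smul_intVec (u : E3) (N : ℕ) (z : Fin 3 → ℤ) :
    ⟪u, (Real.sqrt N)⁻¹ • intVec z⟫ = (Real.sqrt N)⁻¹ * (u.ofLp 0 * z 0 + u.ofLp 1 * z 1 + u.ofLp 2 * z 2) := by
  rw [real_inner_smul_right]
  congr 1
  simp [PiLp.inner_apply, Fin.sum_univ_three, intVec_apply, mul_comm]
/-- `|t| < K ⇒ t² < K²` packaged from the two one-sided bounds. -/
theorem sq_lt_of_two_sided {t K : ℝ} (h1 : t < K) (h2 : -t < K) : t ^ 2 < K ^ 2 :=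
  sq_lt_sq' (by linarith) h1
/-- the fcc two-shell pattern: some pattern vector makes an angle with `u` of cosine `≥ …`; quantitatively `⟪u, v⟫ ≥ ‖u‖/2`. -/
theorem exists_inner_ge_fcc (u : E3) : ∃ v ∈ fccTwoShellPattern, ‖u‖ / 2 ≤ ⟪u, v⟫ := by
  by_contra h
  push Not at h
  have hP : ∀ z ∈ fccInt ∪ fccSecondShellInt,
      (Real.sqrt (2 : ℕ))⁻¹ * (u.ofLp 0 * z 0 + u.ofLp 1 * z 1 + u.ofLp 2 * z 2) < ‖u‖ / 2 := by
    intro z hz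
    have := h _ (Finset.mem_image_of_mem _ hz)
    rwa [inner_smul_intVec] at this
  set s : ℝ := (Real.sqrt (2 : ℕ))⁻¹ with hs
  have hs2 : s ^ 2 = 1 / 2 := by
    rw [hs, inv_pow, Real.sq_sqrt (by norm_num)]; norm_num
  have h0 := hP ![2, 0, 0] (by decide)
  have h0' := hP ![-2, 0, 0] (by decide)
  have h1 := hP ![0, 2, 0] (by decide)
  have h1' := hP ![0, -2, 0] (by decide)
  have h2 := hP ![0, 0, 2] (by decide)
  have h2' := hP ![0, 0, -2] (by decide)
  simp only [Matrix.cons_val_zero, Matrix.cons_val_one, Matrix.cons_val_two, Matrix.head_cons, Matrix.tail_cons,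
    Int.cast_ofNat, Int.cast_neg, Int.cast_zero, mul_zero, add_zero, zero_add, mul_neg] at h0 h0' h1 h1' h2 h2'
  have e0 : (s * (u.ofLp 0 * 2)) ^ 2 < (‖u‖ / 2) ^ 2 := sq_lt_of_two_sided h0 (by linarith)
  have e1 : (s * (u.ofLp 1 * 2)) ^ 2 < (‖u‖ / 2) ^ 2 := sq_lt_of_two_sided h1 (by linarith)
  have e2 : (s * (u.ofLp 2 * 2)) ^ 2 < (‖u‖ / 2) ^ 2 := sq_lt_of_two_sided h2 (by linarith)
  have f0 : (s * (u.ofLp 0 * 2)) ^ 2 = 2 * (u.ofLp 0) ^ 2 := by rw [mul_pow, hs2]; ring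
  have f1 : (s * (u.ofLp 1 * 2)) ^ 2 = 2 * (u.ofLp 1) ^ 2 := by rw [mul_pow, hs2]; ring
  have f2 : (s * (u.ofLp 2 * 2)) ^ 2 = 2 * (u.ofLp 2) ^ 2 := by rw [mul_pow, hs2]; ring
  have hn := norm_sq_eq_sum u
  have hK : (‖u‖ / 2) ^ 2 = ‖u‖ ^ 2 / 4 := by ring
  rw [f0, hK] at e0; rw [f1, hK] at e1; rw [f2, hK] at e2
  nlinarith [sq_nonneg ‖u‖]
/-- the hcp two-shell pattern: the same, via the in-plane hexagon (`±` pairs) and the two triangular caps. -/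
theorem exists_inner_ge_hcp (u : E3) : ∃ v ∈ hcpTwoShellPattern, ‖u‖ / 2 ≤ ⟪u, v⟫ := by
  by_contra h
  push Not at h
  have hP : ∀ z ∈ hcpInt ∪ hcpSecondShellInt,
      (Real.sqrt (18 : ℕ))⁻¹ * (u.ofLp 0 * z 0 + u.ofLp 1 * z 1 + u.ofLp 2 * z 2) < ‖u‖ / 2 := by
    intro z hz
    have := h _ (Finset.mem_image_of_mem _ hz)
    rwa [inner_smul_intVec] at this
  set s : ℝ := (Real.sqrt (18 : ℕ))⁻¹ with hs
  have hs2 : s ^ 2 = 1 / 18 := by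
    rw [hs, inv_pow, Real.sq_sqrt (by norm_num)]; norm_num
  have hspos : 0 < s := by rw [hs]; positivity
  -- hexagon
  have a1 := hP ![3, -3, 0] (by decide)
  have a2 := hP ![-3, 3, 0] (by decide)
  have a3 := hP ![3, 0, -3] (by decide)
  have a4 := hP ![-3, 0, 3] (by decide)
  have a5 := hP ![0, 3, -3] (by decide)
  have a6 := hP ![0, -3, 3] (by decide)
  -- caps
  have b1 := hP ![3, 3, 0] (by decide)
  have b2 := hP ![3, 0, 3] (by decide)
  have b3 := hP ![0, 3, 3] (by decide)
  have c1 := hP ![-1, -1, -4] (by decide)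
  have c2 := hP ![-1, -4, -1] (by decide)
  have c3 := hP ![-4, -1, -1] (by decide)
  simp only [Matrix.cons_val_zero, Matrix.cons_val_one, Matrix.cons_val_two, Matrix.head_cons, Matrix.tail_cons,
    Int.cast_ofNat, Int.cast_neg, Int.cast_zero, Int.cast_one, mul_zero, add_zero, zero_add, mul_neg, mul_one]
    at a1 a2 a3 a4 a5 a6 b1 b2 b3 c1 c2 c3
  set u0 := u.ofLp 0
  set u1 := u.ofLp 1
  set u2 := u.ofLp 2
  have d01 : (s * (3 * (u0 - u1))) ^ 2 < (‖u‖ / 2) ^ 2 := sq_lt_of_two_sided (by linarith) (by linarith)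
  have d02 : (s * (3 * (u0 - u2))) ^ 2 < (‖u‖ / 2) ^ 2 := sq_lt_of_two_sided (by linarith) (by linarith)
  have d12 : (s * (3 * (u1 - u2))) ^ 2 < (‖u‖ / 2) ^ 2 := sq_lt_of_two_sided (by linarith) (by linarith)
  have dσ : (s * (2 * (u0 + u1 + u2))) ^ 2 < (‖u‖ / 2) ^ 2 := sq_lt_of_two_sided (by linarith) (by linarith)
  have f01 : (s * (3 * (u0 - u1))) ^ 2 = (u0 - u1) ^ 2 / 2 := by rw [mul_pow, hs2]; ring
  have f02 : (s * (3 * (u0 - u2))) ^ 2 = (u0 - u2) ^ 2 / 2 := by rw [mul_pow, hs2]; ring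
  have f12 : (s * (3 * (u1 - u2))) ^ 2 = (u1 - u2) ^ 2 / 2 := by rw [mul_pow, hs2]; ring
  have fσ : (s * (2 * (u0 + u1 + u2))) ^ 2 = 2 * (u0 + u1 + u2) ^ 2 / 9 := by rw [mul_pow, hs2]; ring
  have hK : (‖u‖ / 2) ^ 2 = ‖u‖ ^ 2 / 4 := by ring
  rw [f01, hK] at d01; rw [f02, hK] at d02; rw [f12, hK] at d12; rw [fσ, hK] at dσ
  have hn : ‖u‖ ^ 2 = u0 ^ 2 + u1 ^ 2 + u2 ^ 2 := norm_sq_eq_sum u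
  have hid : 3 * ‖u‖ ^ 2 = (u0 - u1) ^ 2 + (u0 - u2) ^ 2 + (u1 - u2) ^ 2 + (u0 + u1 + u2) ^ 2 := by rw [hn]; ring
  nlinarith [sq_nonneg ‖u‖]
/-- ★ both patterns, in the form consumed below. -/
theorem exists_inner_ge_of_pattern {P : Finset E3} (hP : P = fccTwoShellPattern ∨ P = hcpTwoShellPattern) (u : E3) :
    ∃ v ∈ P, ‖u‖ / 2 ≤ ⟪u, v⟫ := by
  rcases hP with rfl | rfl
  · exact exists_inner_ge_fcc u
  · exact exists_inner_ge_hcp u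

/-- pattern vectors have norm `≤ 3/2` (in fact `1` or `√2`). -/
theorem norm_le_of_mem_pattern {P : Finset E3} (hP : P = fccTwoShellPattern ∨ P = hcpTwoShellPattern) {v : E3} (hv : v ∈ P) :
    ‖v‖ ≤ 3 / 2 := by
  have key : ∀ (N : ℕ) (z : Fin 3 → ℤ), (z 0 ^ 2 + z 1 ^ 2 + z 2 ^ 2 : ℤ) ≤ 2 * N → 0 < N →
      ‖(Real.sqrt N)⁻¹ • intVec z‖ ≤ 3 / 2 := by
    intro N z hz hN
    have hNr : (0 : ℝ) < N := by exact_mod_cast hN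
    have hsq : ‖(Real.sqrt N)⁻¹ • intVec z‖ ^ 2 ≤ 2 := by
      rw [norm_smul, mul_pow, norm_inv, Real.norm_eq_abs, abs_of_nonneg (Real.sqrt_nonneg _), inv_pow,
        Real.sq_sqrt hNr.le, norm_sq_eq_sum]
      simp only [intVec_apply]
      rw [inv_mul_le_iff₀ hNr, mul_comm]
      exact_mod_cast hz
    nlinarith [norm_nonneg ((Real.sqrt N)⁻¹ • intVec z)]
  rcases hP with rfl | rfl
  · obtain ⟨z, hz, rfl⟩ := Finset.mem_image.mp hv
    apply key 2 z _ two_pos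
    have := sqNormInt_fccTwoShellInt z hz
    simp only [sqNormInt] at this
    rcases this with h | h <;> omega
  · obtain ⟨z, hz, rfl⟩ := Finset.mem_image.mp hv
    apply key 18 z _ (by norm_num)
    have := sqNormInt_hcpTwoShellInt z hz
    simp only [sqNormInt] at this
    rcases this with h | h <;> omega

/-! ## 2. A separated clean set is relatively dense: every point of space is within distance `5` of it -/

section Density

variable {δ : ℝ} {S : Set E3}

/-- a `δ`-separated set meets every closed ball in a finite set (grid injection of `…NashForceBalance`). -/
theorem finite_sep_inter_closedBall (hδ : 0 < δ) (hS : IsSep δ S) (x : E3) (r : ℝ) : (S ∩ closedBall x r).Finite := by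
  set L : Fin 3 → ℤ := fun i => ⌊2 / δ * (x.ofLp i - r)⌋
  set U : Fin 3 → ℤ := fun i => ⌊2 / δ * (x.ofLp i + r)⌋
  have hc : (0 : ℝ) < 2 / δ := by positivity
  refine Set.Finite.of_injOn (f := grid δ) (t := ↑(Finset.Icc ((L 0, L 1, L 2) : ℤ × ℤ × ℤ) (U 0, U 1, U 2))) ?_
    ((grid_injOn hδ hS).mono Set.inter_subset_left) (Finset.finite_toSet _)
  intro q hq
  have hqx : ‖q - x‖ ≤ r := by rw [← dist_eq_norm]; exact hq.2
  have hco : ∀ i : Fin 3, L i ≤ ⌊2 / δ * q.ofLp i⌋ ∧ ⌊2 / δ * q.ofLp i⌋ ≤ U i := by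
    intro i
    have h := (abs_le.mp ((abs_coord_sub_le_norm q x i).trans hqx))
    constructor
    · exact Int.floor_mono (by nlinarith [h.1])
    · exact Int.floor_mono (by nlinarith [h.2])
  simp only [Finset.coe_Icc, Set.mem_Icc, grid, Prod.mk_le_mk]
  exact ⟨⟨(hco 0).1, (hco 1).1, (hco 2).1⟩, (hco 0).2, (hco 1).2, (hco 2).2⟩

/-- the atoms of the counting measure of `S` are the points of `S`. -/
theorem setOf_μS_ne_zero (S : Set E3) : {p : E3 | μS S {p} ≠ 0} = S := by
  ext p; exact Literature.Probability.Process.count_restrict_singleton_ne_zero_iff S p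

/-- the clean step: from an atom `y` at distance `> 5` from `x`, some two-shell neighbour of `y` is closer to `x` (by `≥ 3a/16`). -/
theorem exists_closer_of_clean (hC : IsClean (μS S)) {x y : E3} (hy : y ∈ S) (hfar : 5 < dist x y) :
    ∃ z ∈ S, dist x z < dist x y := by
  have hy' : μS S {y} ≠ 0 := (Literature.Probability.Process.count_restrict_singleton_ne_zero_iff S y).2 hy
  obtain ⟨a, ha1, ha2, A, P, f, hP, hf, -, -⟩ := hC y hy'
  rw [setOf_μS_ne_zero] at hf
  -- a pattern direction pointing towards `x`
  set Ae := A.toLinearIsometryEquiv rfl with hAe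
  set d : E3 := x - y with hd
  obtain ⟨v, hvP, hv⟩ := exists_inner_ge_of_pattern hP (Ae.symm d)
  have hAd : A (Ae.symm d) = d := by
    have h := LinearIsometryEquiv.apply_symm_apply Ae d
    rw [hAe, LinearIsometry.toLinearIsometryEquiv_apply] at h
    rw [hAe]
    exact h
  have hAv : ⟪d, A v⟫ = ⟪Ae.symm d, v⟫ := by rw [← A.inner_map_map (Ae.symm d) v, hAd]
  rw [LinearIsometryEquiv.norm_map] at hv
  have hD : ‖d‖ = dist x y := by rw [hd, dist_eq_norm]
  have hvn : ‖v‖ ≤ 3 / 2 := norm_le_of_mem_pattern hP hvP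
  have ha0 : 0 < a := by linarith
  -- the neighbour
  obtain ⟨hz, hzd⟩ := hf v hvP
  refine ⟨f v, hz, ?_⟩
  have hmid : dist x (y + a • A v) ≤ dist x y - a / 4 := by
    have hsq : dist x (y + a • A v) ^ 2 ≤ (dist x y - a / 4) ^ 2 := by
      rw [dist_eq_norm, show x - (y + a • A v) = d - a • A v by rw [hd]; abel, norm_sub_sq_real, real_inner_smul_right,
        norm_smul, A.norm_map, Real.norm_eq_abs, abs_of_pos ha0, hAv, ← hD]
      have h1 : (a * ‖v‖) ^ 2 ≤ (a * (3 / 2)) ^ 2 := by gcongr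
      nlinarith [hv, h1, ha2, hfar, hD]
    have hnn : 0 ≤ dist x y - a / 4 := by linarith
    exact (pow_le_pow_iff_left₀ dist_nonneg hnn two_ne_zero).mp hsq
  calc dist x (f v) ≤ dist x (y + a • A v) + dist (y + a • A v) (f v) := dist_triangle _ _ _
    _ ≤ (dist x y - a / 4) + 1 / 16 * a := by rw [dist_comm (y + a • A v)]; exact add_le_add hmid hzd
    _ < dist x y := by linarith
/-- ★ **a separated, clean, nonempty set is `5`-relatively dense**: every point of `E3` is within distance `5` of an atom. -/
theorem exists_mem_dist_le_five (hδ : 0 < δ) (hS : IsSep δ S) (hC : IsClean (μS S)) (hne : S.Nonempty) (x : E3) :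
    ∃ y ∈ S, dist x y ≤ 5 := by
  obtain ⟨y₁, hy₁⟩ := hne
  set F := S ∩ closedBall x (dist x y₁) with hF
  have hFfin : F.Finite := finite_sep_inter_closedBall hδ hS x _
  have hFne : F.Nonempty := ⟨y₁, hy₁, by rw [mem_closedBall, dist_comm]⟩
  obtain ⟨y, hyF, hmin⟩ := Set.exists_min_image F (fun y => dist x y) hFfin hFne
  refine ⟨y, hyF.1, ?_⟩
  by_contra hfar
  push Not at hfar
  obtain ⟨z, hz, hzd⟩ := exists_closer_of_clean hC hyF.1 hfar
  have hzF : z ∈ F := by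
    refine ⟨hz, ?_⟩
    rw [mem_closedBall, dist_comm]
    have := hmin y₁ ⟨hy₁, by rw [mem_closedBall, dist_comm]⟩
    linarith
  have := hmin z hzF
  linarith

end Density

/-! ## 3. Dependent periods are impossible: strictly increasing heights against relative density -/

section Main

variable {δ : ℝ} {a b : E3} {w : ℤ → E3}
/-- dependent pairs lie on a common line `ℝc` with `c ∈ {a, b}`. -/
theorem exists_common_line (h : ¬ LinearIndependent ℝ ![a, b]) :
    ∃ c : E3, (c = a ∨ c = b) ∧ ∃ α β : ℝ, a = α • c ∧ b = β • c := by
  rw [LinearIndependent.pair_iff] at h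
  push Not at h
  obtain ⟨s, t, hst, hne⟩ := h
  by_cases ht : t = 0
  · subst ht
    have hs : s ≠ 0 := fun hs => hne hs rfl
    rw [zero_smul, add_zero] at hst
    have ha : a = 0 := (smul_eq_zero.mp hst).resolve_left hs
    exact ⟨b, Or.inr rfl, 0, 1, by rw [ha, zero_smul], by rw [one_smul]⟩
  · have h2 : t • b = -(s • a) := eq_neg_of_add_eq_zero_right hst
    refine ⟨a, Or.inl rfl, 1, -(t⁻¹ * s), by rw [one_smul], ?_⟩
    calc b = t⁻¹ • (t • b) := by rw [smul_smul, inv_mul_cancel₀ ht, one_smul]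
      _ = -(t⁻¹ * s) • a := by rw [h2, smul_neg, smul_smul, neg_smul]
/-- in `E3` two vectors have a common nonzero perpendicular. -/
theorem exists_orthogonal_pair (n c : E3) : ∃ e : E3, e ≠ 0 ∧ ⟪n, e⟫ = 0 ∧ ⟪c, e⟫ = 0 := by
  set K : Submodule ℝ E3 := Submodule.span ℝ (↑({n, c} : Finset E3)) with hK
  have hK2 : Module.finrank ℝ K ≤ 2 := by
    have h := finrank_span_finset_le_card (R := ℝ) ({n, c} : Finset E3)
    unfold Set.finrank at h
    exact h.trans Finset.card_le_two
  have htot := Submodule.finrank_add_finrank_orthogonal K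
  rw [finrank_euclideanSpace_fin] at htot
  have hpos : 0 < Module.finrank ℝ Kᗮ := by omega
  obtain ⟨e, he⟩ := Module.finrank_pos_iff_exists_ne_zero.mp hpos
  have hmem := (Submodule.mem_orthogonal K e).1 e.2
  refine ⟨e, fun h => he (Subtype.ext h), hmem n (Submodule.subset_span (by simp)), hmem c (Submodule.subset_span (by simp))⟩

/-- inner products with a fixed vector move by at most `‖n‖ r` within distance `r`. -/
theorem abs_inner_sub_inner_le {n x y : E3} {r : ℝ} (h : dist x y ≤ r) : |⟪n, y⟫ - ⟪n, x⟫| ≤ ‖n‖ * r := by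
  rw [← inner_sub_right]
  calc |⟪n, y - x⟫| ≤ ‖n‖ * ‖y - x‖ := abs_real_inner_le_norm _ _
    _ ≤ ‖n‖ * r := by
      rw [← dist_eq_norm, dist_comm]; exact mul_le_mul_of_nonneg_left h (norm_nonneg _)

/- (helper `one_le_abs_sub_of_ne` — distinct naturals are at real distance `≥ 1` — omitted at landing: `dedup.landed` ≡
`Literature.Barriers.PneNP.AppD.Setup.one_le_abs_sub_of_ne`; its one use below is inlined.) -/

/-- ★★ **IND**: the in-plane periods of a `δ`-separated, `(1/16)`-clean, stacked layered set are linearly independent. -/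
theorem linearIndependent_of_clean_stacked (hδ : 0 < δ) (hS : IsSep δ (Layered a b w)) (hC : IsClean (μS (Layered a b w)))
    (hst : IsStacked a b w) : LinearIndependent ℝ ![a, b] := by
  by_contra hdep
  obtain ⟨c, hc, α, β, ha, hb⟩ := exists_common_line hdep
  obtain ⟨n, hna, hnb, hn⟩ := hst
  have hnc : ⟪n, c⟫ = 0 := by rcases hc with rfl | rfl <;> assumption
  obtain ⟨e, he0, hne, hce⟩ := exists_orthogonal_pair n c
  have hea : ⟪e, a⟫ = 0 := by rw [ha, real_inner_smul_right, real_inner_comm, hce, mul_zero]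
  have heb : ⟪e, b⟫ = 0 := by rw [hb, real_inner_smul_right, real_inner_comm, hce, mul_zero]
  have hn0 : n ≠ 0 := by
    intro h; have := hn 0; rw [h, inner_zero_left] at this; exact lt_irrefl _ this
  have hnpos : 0 < ‖n‖ := norm_pos_iff.mpr hn0
  have hepos : 0 < ‖e‖ := norm_pos_iff.mpr he0
  have hmono := strictMono_height hn
  -- coordinates of atoms along `n` and `e` depend only on the layer
  have hcoord : ∀ y ∈ Layered a b w, ∃ l : ℤ, ⟪n, y⟫ = ⟪n, w l⟫ ∧ ⟪e, y⟫ = ⟪e, w l⟫ := by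
    rintro y ⟨l, i, j, rfl⟩
    refine ⟨l, ?_, ?_⟩
    · simp [inner_add_right, inner_smul_right, hna, hnb]
    · simp [inner_add_right, inner_smul_right, hea, heb]
  have hnonempty : (Layered a b w).Nonempty := ⟨w 0, 0, 0, 0, by simp⟩
  have hdense := fun x => exists_mem_dist_le_five hδ hS hC hnonempty x
  -- escape above and below
  have hself : ⟪n, (11 / ‖n‖) • n⟫ = 11 * ‖n‖ := by
    rw [real_inner_smul_right, real_inner_self_eq_norm_sq]; field_simp
  obtain ⟨yu, hyu, hdu⟩ := hdense ((11 / ‖n‖) • n)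
  obtain ⟨yd, hyd, hdd⟩ := hdense (-((11 / ‖n‖) • n))
  obtain ⟨lu, hlu, -⟩ := hcoord yu hyu
  obtain ⟨ld, hld, -⟩ := hcoord yd hyd
  have hup : 6 * ‖n‖ ≤ ⟪n, w lu⟫ := by
    have h := abs_inner_sub_inner_le (n := n) hdu
    rw [hself, hlu] at h
    have := (abs_le.mp h).1; linarith
  have hdown : ⟪n, w ld⟫ ≤ -(6 * ‖n‖) := by
    have h := abs_inner_sub_inner_le (n := n) hdd
    rw [inner_neg_right, hself, hld] at h
    have := (abs_le.mp h).2; linarith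
  have hwindow : ∀ l : ℤ, |⟪n, w l⟫| ≤ ‖n‖ * 5 → ld < l ∧ l < lu := by
    intro l hl
    obtain ⟨h1, h2⟩ := abs_le.mp hl
    constructor
    · by_contra hle
      push Not at hle
      have h3 : ⟪n, w l⟫ ≤ ⟪n, w ld⟫ := hmono.monotone hle
      linarith
    · by_contra hle
      push Not at hle
      have h3 : ⟪n, w lu⟫ ≤ ⟪n, w l⟫ := hmono.monotone hle
      linarith
  -- probes along `e` at height `0`
  set x : ℕ → E3 := fun k => ((11 * k) / ‖e‖) • e with hx
  have hxe : ∀ k : ℕ, ⟪e, x k⟫ = 11 * k * ‖e‖ := by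
    intro k; rw [hx]; dsimp only; rw [real_inner_smul_right, real_inner_self_eq_norm_sq]; field_simp
  have hxn : ∀ k : ℕ, ⟪n, x k⟫ = 0 := by
    intro k; rw [hx]; dsimp only; rw [real_inner_smul_right, hne, mul_zero]
  choose y hyS hyd5 using fun k => hdense (x k)
  choose l hl using fun k => hcoord (y k) (hyS k)
  have hlwin : ∀ k, l k ∈ Finset.Ioo ld lu := by
    intro k
    rw [Finset.mem_Ioo]
    apply hwindow
    rw [← (hl k).1]
    have h := abs_inner_sub_inner_le (n := n) (hyd5 k)
    rwa [hxn k, sub_zero] at h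
  have hlinj : Function.Injective l := by
    intro k k' hkk
    by_contra hne'
    have hk := abs_inner_sub_inner_le (n := e) (hyd5 k)
    have hk' := abs_inner_sub_inner_le (n := e) (hyd5 k')
    rw [hxe k, (hl k).2, hkk] at hk
    rw [hxe k', (hl k').2] at hk'
    have h3 : |(11 * k * ‖e‖ : ℝ) - 11 * k' * ‖e‖| ≤ ‖e‖ * 5 + ‖e‖ * 5 := by
      calc |(11 * k * ‖e‖ : ℝ) - 11 * k' * ‖e‖|
          = |(⟪e, w (l k')⟫ - 11 * k' * ‖e‖) - (⟪e, w (l k')⟫ - 11 * k * ‖e‖)| := by ring_nf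
        _ ≤ |⟪e, w (l k')⟫ - 11 * k' * ‖e‖| + |⟪e, w (l k')⟫ - 11 * k * ‖e‖| := abs_sub _ _
        _ ≤ ‖e‖ * 5 + ‖e‖ * 5 := add_le_add hk' hk
    have h4 : |(11 * k * ‖e‖ : ℝ) - 11 * k' * ‖e‖| = 11 * ‖e‖ * |(k : ℝ) - k'| := by
      rw [show (11 * k * ‖e‖ : ℝ) - 11 * k' * ‖e‖ = (11 * ‖e‖) * ((k : ℝ) - k') by ring, abs_mul,
        abs_of_pos (by positivity)]
    rw [h4] at h3
    have h5 : (1 : ℝ) ≤ |(k : ℝ) - k'| := by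
      rcases lt_or_gt_of_ne hne' with hlt | hlt
      · have : (k : ℝ) + 1 ≤ k' := by exact_mod_cast hlt
        rw [abs_of_nonpos (by linarith)]; linarith
      · have : (k' : ℝ) + 1 ≤ k := by exact_mod_cast hlt
        rw [abs_of_nonneg (by linarith)]; linarith
    nlinarith
  have hcard := Finset.card_le_card_of_injOn l (s := Finset.range ((lu - ld).toNat + 1)) (t := Finset.Ioo ld lu)
    (fun k _ => Finset.mem_coe.2 (hlwin k)) hlinj.injOn
  rw [Finset.card_range, Int.card_Ioo] at hcard
  omega

/-- ★ packaged in the binder order of `…ProfileSlavingLJLayerBalance.CleanStackedIndependent` (stated here verbatim, so that the corollary module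
can discharge its hypothesis by `cleanStackedIndependent`). -/
theorem cleanStackedIndependent :
    ∀ δ : ℝ, 0 < δ → ∀ (a b : E3) (w : ℤ → E3),
      IsSep δ (Layered a b w) → IsClean (μS (Layered a b w)) → IsStacked a b w → LinearIndependent ℝ ![a, b] :=
  fun _ hδ _ _ _ hS hC hst => linearIndependent_of_clean_stacked hδ hS hC hst

end Main

end Summit.AtomisticToContinuum.Crystallization.Theorems.ChartedPlanarOrderCleanStackedIndependent
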